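import Literature.Barriers.CriticalPhenomena.LaceExpansionXSpaceNormsReduction
import Literature.Barriers.CriticalPhenomena.LaceExpansionXSpaceNormsFractional
import Literature.Barriers.CriticalPhenomena.LaceExpansionXSpaceNormsTop
import HarnessLib

/-!
# Hara 2008, Lemma 1.7 (`Hara2008_lemma17Pc`): the five clauses assembled from the two remaining
# analytic inputs — fractional weights below `⌊φ⌋` and the top exponents `⌊φ⌋ < α ≤ φ`

Barrier catalogue `Literature/Barriers/CriticalPhenomena/` (D-0021), proofs file of
`LaceExpansionXSpaceNorms.lean` (the named fact `Hara2008_lemma17Pc`: Hara 2008, Lemma 1.7 at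
`p_c`, `d ≥ 11`). On top of the `x`-space layer `LaceExpansionXSpaceNormsReduction.lean` (the
clauses `Ḡ, W̄, T̄, S̄` from `L^p`-dominated coordinate weights `G_j^{(β)} = |x_j|^β τ_{p_c}(0,x)`,
`H̄ ≤ W̄^{(β,0)} W̄^{(0,0)} S̄^{(0)}`, the integer engine for even exponents) and the tree's
`Ḡ`-clause for integer orders (`IsLaceCoefficientPc.haraGBar_lt_top_of_rpow`,
`LaceExpansionHaraLemma17G.lean`), this file PROVES that the whole of `Hara2008_lemma17Pc` follows
from two analytic statements about the critical two-point function, stated as hypotheses: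

* (fractional engine — Hara's Lemma 4.2 with the power counting of §4.1.3) for non-integer
  `0 < β < ⌊φ⌋` and `p ≥ 1` with `(2 + β)p < d`, `G_j^{(β)}` is `L^p`-dominated
  (`HaraNorms.LpDominated (coordG d β j) p`);
* (top engine — §4.1.4) for `⌊φ⌋ < α ≤ φ`, `α < d - 2`: `sup_x |x_j|^α τ_{p_c}(0,x) < ∞`.

Contents: the exponent bookkeeping (`int_floor_cast_eq_nat_floor`, `even_or_forall_ne_intCast`:
a nonnegative real which is not an odd integer is `2b` or not an integer),
`lpDominated_coordG_of_admissible` (admissible exponents `0 ≤ β ≤ ⌊φ⌋`, `β ∉ 2ℤ+1`, are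
`L^p`-dominated for `(2+β)p < d`), the clauses `haraGBar/WBar/TBar/SBar/HBar_lt_top_of_engines`
(the `W̄`/`T̄` clauses come out WITHOUT Hara's extra restriction `β + γ - (⌊β⌋ + ⌊γ⌋) < 1`, an
artefact of putting both fractional kernels on the same coordinate in (4.18); the `Ḡ`-clause needs
no parity restriction), `Hara2008_lemma17Pc_of_engines`, and — with the two engines of
`LaceExpansionXSpaceNormsFractional.lean` (`Hara2008_lemma17Pc_hfrac`: dyadic second-difference
smears for the non-integer exponents below `⌊φ⌋`) and `LaceExpansionXSpaceNormsTop.lean`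
(`Hara2008_lemma17Pc_htop`: one finite difference at the scale `π/|x_l|` for `⌊φ⌋ < α ≤ φ`) —
**the discharge `Hara2008_lemma17Pc_holds`** of the named fact.

## References

* T. Hara, Ann. Probab. 36 (2008) 530–593 (arXiv:math-ph/0504021): Lemma 1.7 (§1.2.4,
  (1.30)–(1.34)), §4.1.2 (even integers), §4.1.3 (Lemma 4.2, (4.16)–(4.19)), §4.1.4 (`α > ⌊φ⌋`).
-/

noncomputable section

namespace Literature.Barriers.CriticalPhenomena

open _root_.MeasureTheory _root_.Filter Finset Literature.Probability.LatticeModels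
  Literature.Probability.Percolation HaraNorms

open scoped ENNReal NNReal BigOperators

variable {d : ℕ}

/-! ### Exponent bookkeeping -/

/-- For `φ ≥ 0` the integer and natural floors agree as real numbers. [folklore] -/
theorem int_floor_cast_eq_nat_floor {φ : ℝ} (hφ : 0 ≤ φ) : ((⌊φ⌋ : ℤ) : ℝ) = ((⌊φ⌋₊ : ℕ) : ℝ) := by
  rw [← Int.natCast_floor_eq_floor hφ]
  rfl

/-- A nonnegative real which is not an odd integer is an even natural number or not an integer at
all. [cite: Hara2008, Lemma 1.7 ("for nonnegative α, β, γ which are not odd integers")] -/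
theorem even_or_forall_ne_intCast {β : ℝ} (hβ : 0 ≤ β) (hodd : ¬ IsOddInt β) :
    (∃ b : ℕ, β = 2 * (b : ℝ)) ∨ (∀ n : ℤ, β ≠ n) := by
  by_cases hint : ∃ n : ℤ, β = n
  · obtain ⟨n, rfl⟩ := hint
    left
    have hn0 : 0 ≤ n := by exact_mod_cast hβ
    obtain ⟨k, hk | hk⟩ := Int.even_or_odd' n
    · refine ⟨k.toNat, ?_⟩
      have hk0 : 0 ≤ k := by omega
      rw [hk]
      push_cast
      rw [show ((k : ℤ) : ℝ) = ((k.toNat : ℕ) : ℝ) by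
        rw [show ((k.toNat : ℕ) : ℝ) = (((k.toNat : ℕ) : ℤ) : ℝ) by norm_cast, Int.toNat_of_nonneg hk0]]
    · exact absurd ⟨k, by rw [hk]; push_cast; ring⟩ hodd
  · right
    intro n hn
    exact hint ⟨n, hn⟩

/-- A non-integer real below an integer bound is strictly below it. [folklore] -/
theorem lt_of_le_of_forall_ne_intCast {β : ℝ} {M : ℕ} (hle : β ≤ M) (hne : ∀ n : ℤ, β ≠ n) : β < M :=
  lt_of_le_of_ne hle fun h => hne M (by rw [h]; norm_cast)

/-- A nonnegative non-integer real is positive. [folklore] -/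
theorem pos_of_nonneg_of_forall_ne_intCast {β : ℝ} (hβ : 0 ≤ β) (hne : ∀ n : ℤ, β ≠ n) : 0 < β :=
  lt_of_le_of_ne hβ fun h => hne 0 (by rw [← h]; norm_cast)

/-! ### The two remaining analytic inputs, as hypotheses -/

section Engines

variable {Φ : Site d → ℝ} {φ : ℝ}

/-- **Admissible exponents are `L^p`-dominated** (given the fractional engine): for
`0 ≤ β ≤ ⌊φ⌋`, `β` not an odd integer, `p ≥ 1`, `(2 + β)p < d`, the weight `G_j^{(β)}` is
`L^p`-dominated — even integers by `(-1)^b ∂_j^{2b} Ĝ` (the integer engine), the other exponents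
by the hypothesis `hfrac` (Hara's Lemma 4.2). [cite: Hara2008, §4.1.2–§4.1.3 (Lemmas 4.1, 4.2)] -/
theorem lpDominated_coordG_of_admissible (h : IsLaceCoefficientPc d Φ) (hφ2 : 2 ≤ φ)
    (hmom : Summable fun x => euclidNorm x ^ φ * |Φ x|)
    (hfrac : ∀ (j : Fin d) (β p : ℝ), 0 < β → β < ⌊φ⌋₊ → (∀ n : ℤ, β ≠ n) → 1 ≤ p →
      (2 + β) * p < d → LpDominated (coordG d β j) p)
    (j : Fin d) {β : ℝ} (hβ : 0 ≤ β) (hodd : ¬ IsOddInt β) (hβφ : β ≤ ⌊φ⌋₊) {p : ℝ} (hp : 1 ≤ p)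
    (hpd : (2 + β) * p < d) : LpDominated (coordG d β j) p := by
  rcases even_or_forall_ne_intCast hβ hodd with ⟨b, rfl⟩ | hne
  · refine h.lpDominated_coordG_even_of_rpow hφ2 hmom j ?_ hp (by linarith)
    exact_mod_cast (show ((2 * b : ℕ) : ℝ) ≤ ⌊φ⌋₊ by push_cast; exact hβφ)
  · exact hfrac j β p (pos_of_nonneg_of_forall_ne_intCast hβ hne)
      (lt_of_le_of_forall_ne_intCast hβφ hne) hne hp hpd

/-- **The `Ḡ`-clause** from the two engines: `Ḡ^{(α)} < ∞` for `0 ≤ α ≤ φ`, `α < d - 2` (`d ≥ 3`;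
odd integers need not be excluded here). Integer-order cases `⌈α⌉ ≤ ⌊φ⌋`, `⌈α⌉ + 3 ≤ d` by
`IsLaceCoefficientPc.haraGBar_lt_top_of_rpow`; `d - 3 < α < d - 2` by the fractional engine at
`p = 1`; `⌊φ⌋ < α ≤ φ` by the top engine. [cite: Hara2008, Lemma 1.7 ((1.30)), §4.1.2–§4.1.4] -/
theorem haraGBar_lt_top_of_engines (h : IsLaceCoefficientPc d Φ) (hφ2 : 2 ≤ φ)
    (hmom : Summable fun x => euclidNorm x ^ φ * |Φ x|) (hd : 3 ≤ d)
    (hfrac : ∀ (j : Fin d) (β p : ℝ), 0 < β → β < ⌊φ⌋₊ → (∀ n : ℤ, β ≠ n) → 1 ≤ p →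
      (2 + β) * p < d → LpDominated (coordG d β j) p)
    (htop : ∀ (j : Fin d) (α : ℝ), (⌊φ⌋₊ : ℝ) < α → α ≤ φ → α < (d : ℝ) - 2 →
      ∃ C : ℝ, ∀ y, coordG d α j y ≤ C)
    {α : ℝ} (hα : 0 ≤ α) (hαφ : α ≤ φ) (hαd : α < (d : ℝ) - 2) :
    haraGBar d α < ⊤ := by
  have hd1 : 1 ≤ d := by omega
  by_cases htopcase : (⌊φ⌋₊ : ℝ) < α
  · exact haraGBar_lt_top_of_coordG_le hd1 hα fun j => htop j α htopcase hαφ hαd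
  · have htopcase : α ≤ ⌊φ⌋₊ := not_lt.1 htopcase
    have hceilM : ⌈α⌉₊ ≤ ⌊φ⌋₊ := Nat.ceil_le.2 htopcase
    by_cases hlow : ⌈α⌉₊ + 3 ≤ d
    · exact h.haraGBar_lt_top_of_rpow hφ2 hmom hceilM hlow
    · -- `d - 3 < α < d - 2`: `α` is not an integer; the fractional engine at `p = 1`
      have hne : ∀ n : ℤ, α ≠ n := by
        intro n hn
        have hn0 : 0 ≤ n := by exact_mod_cast (hn ▸ hα : (0 : ℝ) ≤ n)
        have hceil : ⌈α⌉₊ = n.toNat := by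
          rw [hn, show ((n : ℤ) : ℝ) = ((n.toNat : ℕ) : ℝ) by
            rw [show ((n.toNat : ℕ) : ℝ) = (((n.toNat : ℕ) : ℤ) : ℝ) by norm_cast, Int.toNat_of_nonneg hn0],
            Nat.ceil_natCast]
        have h1 : (n.toNat : ℝ) < d - 2 := by
          rw [show ((n.toNat : ℕ) : ℝ) = (((n.toNat : ℕ) : ℤ) : ℝ) by norm_cast, Int.toNat_of_nonneg hn0, ← hn]
          exact hαd
        have h2 : n.toNat + 3 ≤ d := by
          have : (n.toNat : ℝ) + 2 < d := by linarith
          have : n.toNat + 2 < d := by exact_mod_cast this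
          omega
        exact hlow (hceil ▸ h2)
      have hpos : 0 < α := pos_of_nonneg_of_forall_ne_intCast hα hne
      have hlt : α < ⌊φ⌋₊ := lt_of_le_of_forall_ne_intCast htopcase hne
      refine haraGBar_lt_top_of_lpDominated hd1 hα fun j => hfrac j α 1 hpos hlt hne le_rfl ?_
      linarith

/-- **The `W̄`-clause** from the fractional engine: `W̄^{(β,γ)} < ∞` for `0 ≤ β, γ ≤ ⌊φ⌋` not odd
integers with `β + γ < d - 4` (Hara's further restriction `β + γ - (⌊β⌋ + ⌊γ⌋) < 1` is not
needed in this form). [cite: Hara2008, Lemma 1.7 ((1.31)), §4.1.2–§4.1.3] -/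
theorem haraWBar_lt_top_of_engines (h : IsLaceCoefficientPc d Φ) (hφ2 : 2 ≤ φ)
    (hmom : Summable fun x => euclidNorm x ^ φ * |Φ x|)
    (hfrac : ∀ (j : Fin d) (β p : ℝ), 0 < β → β < ⌊φ⌋₊ → (∀ n : ℤ, β ≠ n) → 1 ≤ p →
      (2 + β) * p < d → LpDominated (coordG d β j) p)
    {β γ : ℝ} (hβ : 0 ≤ β) (hγ : 0 ≤ γ) (hβo : ¬ IsOddInt β) (hγo : ¬ IsOddInt γ)
    (hβφ : β ≤ ⌊φ⌋₊) (hγφ : γ ≤ ⌊φ⌋₊) (hsum : β + γ < (d : ℝ) - 4) : haraWBar d β γ < ⊤ := by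
  obtain ⟨w₀, w₁, hw₀, hw₁, hw, h1₀, h1₁, hA, hB⟩ :=
    HaraNorms.exists_weights₂ (A := 2 + β) (B := 2 + γ) (D := d) (by linarith) (by linarith) (by linarith)
  have hd : 1 ≤ d := by
    have : (0 : ℝ) < d := by linarith
    exact_mod_cast this
  exact haraWBar_lt_top_of_lpDominated hd hβ hγ hw₀ hw₁ hw
    (fun j => lpDominated_coordG_of_admissible h hφ2 hmom hfrac j hβ hβo hβφ h1₀ hA)
    (fun l => lpDominated_coordG_of_admissible h hφ2 hmom hfrac l hγ hγo hγφ h1₁ hB)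

/-- **The `T̄`-clause** from the fractional engine: `T̄^{(β,γ)} < ∞` for `0 ≤ β, γ ≤ ⌊φ⌋` not odd
integers with `β + γ < d - 6`. [cite: Hara2008, Lemma 1.7 ((1.32)), §4.1.2–§4.1.3] -/
theorem haraTBar_lt_top_of_engines (h : IsLaceCoefficientPc d Φ) (hφ2 : 2 ≤ φ)
    (hmom : Summable fun x => euclidNorm x ^ φ * |Φ x|)
    (hfrac : ∀ (j : Fin d) (β p : ℝ), 0 < β → β < ⌊φ⌋₊ → (∀ n : ℤ, β ≠ n) → 1 ≤ p →
      (2 + β) * p < d → LpDominated (coordG d β j) p)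
    {β γ : ℝ} (hβ : 0 ≤ β) (hγ : 0 ≤ γ) (hβo : ¬ IsOddInt β) (hγo : ¬ IsOddInt γ)
    (hβφ : β ≤ ⌊φ⌋₊) (hγφ : γ ≤ ⌊φ⌋₊) (hsum : β + γ < (d : ℝ) - 6) : haraTBar d β γ < ⊤ := by
  obtain ⟨w₀, w₁, w₂, hw₀, hw₁, hw₂, hw, h1₀, h1₁, h1₂, hA, hB, hC⟩ :=
    HaraNorms.exists_weights₃ (A := 2 + β) (B := 2 + γ) (C := 2) (D := d) (by linarith) (by linarith)
      two_pos (by linarith)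
  have hd : 1 ≤ d := by
    have : (0 : ℝ) < d := by linarith
    exact_mod_cast this
  exact haraTBar_lt_top_of_lpDominated hd hβ hγ hw₀ hw₁ hw₂ hw
    (fun j => lpDominated_coordG_of_admissible h hφ2 hmom hfrac j hβ hβo hβφ h1₀ hA)
    (fun l => lpDominated_coordG_of_admissible h hφ2 hmom hfrac l hγ hγo hγφ h1₁ hB)
    (h.lpDominated_tau_of_rpow hφ2 hmom h1₂ hC)

/-- **The `S̄`-clause** from the fractional engine: `S̄^{(γ)} < ∞` for `0 ≤ γ ≤ ⌊φ⌋` not an odd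
integer with `γ < d - 8`. [cite: Hara2008, Lemma 1.7 ((1.33)), §4.1.2–§4.1.3] -/
theorem haraSBar_lt_top_of_engines (h : IsLaceCoefficientPc d Φ) (hφ2 : 2 ≤ φ)
    (hmom : Summable fun x => euclidNorm x ^ φ * |Φ x|)
    (hfrac : ∀ (j : Fin d) (β p : ℝ), 0 < β → β < ⌊φ⌋₊ → (∀ n : ℤ, β ≠ n) → 1 ≤ p →
      (2 + β) * p < d → LpDominated (coordG d β j) p)
    {γ : ℝ} (hγ : 0 ≤ γ) (hγo : ¬ IsOddInt γ) (hγφ : γ ≤ ⌊φ⌋₊) (hγd : γ < (d : ℝ) - 8) :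
    haraSBar d γ < ⊤ := by
  obtain ⟨w₀, w₁, w₂, w₃, hw₀, hw₁, hw₂, hw₃, hw, h1₀, h1₁, h1₂, h1₃, hA, hB, hC, hE⟩ :=
    HaraNorms.exists_weights₄ (A := 2 + γ) (B := 2) (C := 2) (E := 2) (D := d) (by linarith)
      two_pos two_pos two_pos (by linarith)
  have hd : 1 ≤ d := by
    have : (0 : ℝ) < d := by linarith
    exact_mod_cast this
  exact haraSBar_lt_top_of_lpDominated hd hγ hw₀ hw₁ hw₂ hw₃ hw
    (fun j => lpDominated_coordG_of_admissible h hφ2 hmom hfrac j hγ hγo hγφ h1₀ hA)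
    (h.lpDominated_tau_of_rpow hφ2 hmom h1₁ hB) (h.lpDominated_tau_of_rpow hφ2 hmom h1₂ hC)
    (h.lpDominated_tau_of_rpow hφ2 hmom h1₃ hE)

/-- **The `H̄`-clause** from the fractional engine: `H̄^{(β)} < ∞` for `0 ≤ β ≤ ⌊φ⌋` not an odd
integer with `β < d - 4`, `d > 8` (through `H̄ ≤ W̄^{(β,0)} W̄^{(0,0)} S̄^{(0)}`).
[cite: Hara2008, Lemma 1.7 ((1.34)), §4.1.2] -/
theorem haraHBar_lt_top_of_engines (h : IsLaceCoefficientPc d Φ) (hφ2 : 2 ≤ φ)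
    (hmom : Summable fun x => euclidNorm x ^ φ * |Φ x|)
    (hfrac : ∀ (j : Fin d) (β p : ℝ), 0 < β → β < ⌊φ⌋₊ → (∀ n : ℤ, β ≠ n) → 1 ≤ p →
      (2 + β) * p < d → LpDominated (coordG d β j) p)
    {β : ℝ} (hβ : 0 ≤ β) (hβo : ¬ IsOddInt β) (hβφ : β ≤ ⌊φ⌋₊) (hβd : β < (d : ℝ) - 4)
    (hd8 : 8 < d) : haraHBar d β < ⊤ := by
  have h0o : ¬ IsOddInt 0 := by
    rintro ⟨n, hn⟩
    have h1 : (2 * n + 1 : ℝ) = 0 := by exact_mod_cast hn.symm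
    have h2 : (2 * n + 1 : ℤ) = 0 := by exact_mod_cast h1
    omega
  have hd8' : (8 : ℝ) < d := by exact_mod_cast hd8
  have hW := haraWBar_lt_top_of_engines h hφ2 hmom hfrac hβ le_rfl hβo h0o hβφ (Nat.cast_nonneg _)
    (by linarith)
  have hW0 := haraWBar_lt_top_of_engines h hφ2 hmom hfrac le_rfl le_rfl h0o h0o (Nat.cast_nonneg _)
    (Nat.cast_nonneg _) (by linarith)
  have hS := haraSBar_lt_top_of_engines h hφ2 hmom hfrac le_rfl h0o (Nat.cast_nonneg _) (by linarith)
  exact haraHBar_lt_top_of_bars hW hW0 hS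

end Engines

/-! ### Lemma 1.7 from the two engines -/

/-- **Hara 2008, Lemma 1.7 at `p_c` (`Hara2008_lemma17Pc`) from the two remaining analytic
inputs.** If, for every `d ≥ 11`, every lace-expansion coefficient `Φ` with
`Σ_x |x|^φ |Π(x)| < ∞` (`φ ≥ 2`):
(fractional engine) `G_j^{(β)} = |x_j|^β τ_{p_c}(0,x)` is `L^p`-dominated for every non-integer
`0 < β < ⌊φ⌋` and `p ≥ 1` with `(2 + β)p < d` (Hara's Lemma 4.2 with the power counting of
§4.1.3), and (top engine) `sup_x |x_j|^α τ_{p_c}(0,x) < ∞` for `⌊φ⌋ < α ≤ φ`, `α < d - 2` (§4.1.4),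
then all five clauses of Lemma 1.7 hold. [cite: Hara2008, Lemma 1.7 and §4.1] -/
theorem Hara2008_lemma17Pc_of_engines
    (hfrac : ∀ (d : ℕ), 11 ≤ d → ∀ Φ : Site d → ℝ, IsLaceCoefficientPc d Φ → ∀ φ : ℝ, 2 ≤ φ →
      (Summable fun x : Site d => euclidNorm x ^ φ * |Φ x|) →
      ∀ (j : Fin d) (β p : ℝ), 0 < β → β < ⌊φ⌋₊ → (∀ n : ℤ, β ≠ n) → 1 ≤ p → (2 + β) * p < d →
        LpDominated (coordG d β j) p)
    (htop : ∀ (d : ℕ), 11 ≤ d → ∀ Φ : Site d → ℝ, IsLaceCoefficientPc d Φ → ∀ φ : ℝ, 2 ≤ φ →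
      (Summable fun x : Site d => euclidNorm x ^ φ * |Φ x|) →
      ∀ (j : Fin d) (α : ℝ), (⌊φ⌋₊ : ℝ) < α → α ≤ φ → α < (d : ℝ) - 2 →
        ∃ C : ℝ, ∀ y, coordG d α j y ≤ C) :
    Hara2008_lemma17Pc := by
  intro d hd Φ hΦ φ hφ2 hmom
  have hfr := hfrac d hd Φ hΦ φ hφ2 hmom
  have htp := htop d hd Φ hΦ φ hφ2 hmom
  have hfl : ((⌊φ⌋ : ℤ) : ℝ) = ((⌊φ⌋₊ : ℕ) : ℝ) := int_floor_cast_eq_nat_floor (by linarith)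
  refine ⟨fun α hα _ hαφ hαd => ?_, fun β γ hβ hγ hβo hγo hβφ hγφ hsum _ => ?_,
    fun β γ hβ hγ hβo hγo hβφ hγφ hsum _ => ?_, fun γ hγ hγo hγφ hγd => ?_,
    fun β hβ hβo hβφ hβd _ => ?_⟩
  · exact haraGBar_lt_top_of_engines hΦ hφ2 hmom (by omega) hfr htp hα hαφ hαd
  · rw [hfl] at hβφ hγφ
    exact haraWBar_lt_top_of_engines hΦ hφ2 hmom hfr hβ hγ hβo hγo hβφ hγφ hsum
  · rw [hfl] at hβφ hγφ
    exact haraTBar_lt_top_of_engines hΦ hφ2 hmom hfr hβ hγ hβo hγo hβφ hγφ hsum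
  · rw [hfl] at hγφ
    exact haraSBar_lt_top_of_engines hΦ hφ2 hmom hfr hγ hγo hγφ hγd
  · rw [hfl] at hβφ
    exact haraHBar_lt_top_of_engines hΦ hφ2 hmom hfr hβ hβo hβφ hβd (by omega)

/-! ### The discharge -/

/-- **Hara 2008, Lemma 1.7 at `p_c` for `d ≥ 11` — `Hara2008_lemma17Pc` PROVED**: for every
lace-expansion coefficient `Φ = Π_{p_c}` of critical bond percolation on `ℤ^d`, `d ≥ 11`
(`IsLaceCoefficientPc d Φ`) and every `φ ≥ 2` with `Σ_x |x|^φ |Π(x)| < ∞`, the weighted diagrams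
`Ḡ^{(α)}, W̄^{(β,γ)}, T̄^{(β,γ)}, S̄^{(γ)}, H̄^{(β)}` are finite in the printed ranges of exponents. The
analytic core (Hara's §4) is formalised with Lemma 4.1 (`LaceExpansionHaraLemma41*.lean`), the
diagram bound by Fejér regularisation (`LaceExpansionXSpaceNormsFejer.lean`), finite differences in
place of the fractional-derivative kernels of §4.3–§4.4 (`LaceExpansionFractionalSmear*.lean`,
`LaceExpansionXSpaceNormsSlices.lean`, `…Fractional.lean`, `…Top.lean`), and the `x`-space bound
`H̄ ≤ W̄^{(β,0)} W̄^{(0,0)} S̄^{(0)}` (`…Reduction.lean`) in place of the `3d`-dimensional integral (4.15).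
[cite: Hara2008, Lemma 1.7 and §4] [cite: FitznerVanDerHofstad2017, Thm. 1.1, §2.6 and §7] -/
theorem Hara2008_lemma17Pc_holds : Hara2008_lemma17Pc :=
  Hara2008_lemma17Pc_of_engines Hara2008_lemma17Pc_hfrac Hara2008_lemma17Pc_htop

end Literature.Barriers.CriticalPhenomena
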